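import Mathlib
import Summits.NavierStokesRegularity.FluidComputer.AbcFlowCubeTailForms
import HarnessLib

/-!
# The `H²` tail numbers of the ABC linearisation at `R = 13`, `ω = −1/100000`, on the P-ONSET13-3L ladder (cap g6, cell `ns-blowup`, 2026-08-26)

HONEST FRAMING (human ruling D-0035): nothing here is a claim about Navier–Stokes blow-up.
WHAT THIS IS NOT: not NS evidence. Twin of `AbcFlowCubeTailAt25` (p437718, the D2 instance at
`(R, ω, K) = (100, 11/50, 24)`) for the pre-registered exclusion line P-ONSET13-3L
(`HOME/cap/P-ONSET13-3L-PREREG-DRAFT.md`): 3-L Lyapunov certificates of the MODEL linearisation about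
`U = abc(1,1,1)` at `R = 13` with the NEGATIVE rate `ω = −1/100000`, read as «no eigenvalue with
`Re λ > ω`» (`LyapunovEigenvalueExclusion`). With `κ₀ = 0` the only analytic tail level is the `H²`
one, `η₂(K+1) = ν(K+1)² + ω − (2√3+√2) − (√6+2√3)/(K+1) − √3/(K+1)²`, `ν = 1/13`; the ladder of
head cut-offs `K ∈ {10, 12, 13, 14, 16}` gives `K + 1 ∈ {11, 13, 14, 15, 17}`.

* `eta2_R13_gt` family — the threshold arithmetic: `η₂(11) > 3.876`, `η₂(13) > 7.655`,
  `η₂(14) > 9.766`, `η₂(15) > 12.026`, `η₂(17) > 16.998` (desk values 3.8772 / 7.6563 / 9.7669 /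
  12.0269 / 16.9990).
* `abc_cube_h2_tail_at_R13` — for `U = Torus.abcFlow 1 1 1` on the unit torus and every smooth `w`
  whose Fourier coefficients vanish on the cube `|k|_∞ ≤ K`: if `c ≤ η₂(K+1)` then
  `(ν/4π²)∫⟪ΔΔw,Δw⟫ − (1/2π)∫⟪(U·∇)w + (w·∇)U, ΔΔw⟫ − ω‖Δw‖₂² ≤ −c·‖Δw‖₂²` (`ν = 1/13`,
  `ω = −1/100000`), and its five ladder instances `abc_cube_h2_tail_at_R13_K10/12/13/14/16` — the
  TAIL hypothesis of `ShellBlockLyapunovCertificate.generator_form_le_of_certificate` (in the `g₀`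
  norm, `y_t = Δv_t`) as a theorem about the tree's ABC field, for whichever rung the pilot selects.

Mathlib + `AbcFlowCubeTailForms`; no new definitions.
-/

noncomputable section

namespace Summit.NavierStokesRegularity.FluidComputer.AbcFlowCubeTailAtR13

open Literature.Analysis.FluidPDE Literature.Analysis.FunctionSpaces
open Literature.Analysis.FunctionSpaces.Torus MeasureTheory UnitAddTorus
open Summit.NavierStokesRegularity.FluidComputer.AbcFlowCubeTailForms
open scoped RealInnerProductSpace

/-- `1.41421 < √2 < 1.41422`. -/
private theorem sqrt2_bounds : (1.41421 : ℝ) < Real.sqrt 2 ∧ Real.sqrt 2 < 1.41422 := by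
  constructor
  · rw [show (1.41421 : ℝ) = Real.sqrt (1.41421 ^ 2) by rw [Real.sqrt_sq (by norm_num)]]
    exact Real.sqrt_lt_sqrt (by norm_num) (by norm_num)
  · rw [show (1.41422 : ℝ) = Real.sqrt (1.41422 ^ 2) by rw [Real.sqrt_sq (by norm_num)]]
    exact Real.sqrt_lt_sqrt (by norm_num) (by norm_num)

/-- `1.73205 < √3 < 1.73206`. -/
private theorem sqrt3_bounds : (1.73205 : ℝ) < Real.sqrt 3 ∧ Real.sqrt 3 < 1.73206 := by
  constructor
  · rw [show (1.73205 : ℝ) = Real.sqrt (1.73205 ^ 2) by rw [Real.sqrt_sq (by norm_num)]]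
    exact Real.sqrt_lt_sqrt (by norm_num) (by norm_num)
  · rw [show (1.73206 : ℝ) = Real.sqrt (1.73206 ^ 2) by rw [Real.sqrt_sq (by norm_num)]]
    exact Real.sqrt_lt_sqrt (by norm_num) (by norm_num)

/-- `2.44948 < √6 < 2.44949`. -/
private theorem sqrt6_bounds : (2.44948 : ℝ) < Real.sqrt 6 ∧ Real.sqrt 6 < 2.44949 := by
  constructor
  · rw [show (2.44948 : ℝ) = Real.sqrt (2.44948 ^ 2) by rw [Real.sqrt_sq (by norm_num)]]
    exact Real.sqrt_lt_sqrt (by norm_num) (by norm_num)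
  · rw [show (2.44949 : ℝ) = Real.sqrt (2.44949 ^ 2) by rw [Real.sqrt_sq (by norm_num)]]
    exact Real.sqrt_lt_sqrt (by norm_num) (by norm_num)

/-- The `H²` tail level of the ABC linearisation at `R = 13`, `ω = −1/100000`, as a function of the
first tail shell `n = K + 1`: `η₂(n) = n²/13 − 1/100000 − (2√3+√2) − (√6+2√3)/n − √3/n²`
(written inline in each statement below; no definition is introduced). -/
theorem eta2_R13_11_gt :
    (3.876 : ℝ) < (1 / 13 : ℝ) * 11 ^ 2 + (-(1 / 100000 : ℝ)) - (2 * Real.sqrt 3 + Real.sqrt 2)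
        - (Real.sqrt 6 + 2 * Real.sqrt 3) / 11 - Real.sqrt 3 / 11 ^ 2 := by
  obtain ⟨a2, b2⟩ := sqrt2_bounds
  obtain ⟨a3, b3⟩ := sqrt3_bounds
  obtain ⟨a6, b6⟩ := sqrt6_bounds
  nlinarith

/-- `η₂(13) > 7.655` (desk `7.6563`). -/
theorem eta2_R13_13_gt :
    (7.655 : ℝ) < (1 / 13 : ℝ) * 13 ^ 2 + (-(1 / 100000 : ℝ)) - (2 * Real.sqrt 3 + Real.sqrt 2)
        - (Real.sqrt 6 + 2 * Real.sqrt 3) / 13 - Real.sqrt 3 / 13 ^ 2 := by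
  obtain ⟨a2, b2⟩ := sqrt2_bounds
  obtain ⟨a3, b3⟩ := sqrt3_bounds
  obtain ⟨a6, b6⟩ := sqrt6_bounds
  nlinarith

/-- `η₂(14) > 9.766` (desk `9.7669`). -/
theorem eta2_R13_14_gt :
    (9.766 : ℝ) < (1 / 13 : ℝ) * 14 ^ 2 + (-(1 / 100000 : ℝ)) - (2 * Real.sqrt 3 + Real.sqrt 2)
        - (Real.sqrt 6 + 2 * Real.sqrt 3) / 14 - Real.sqrt 3 / 14 ^ 2 := by
  obtain ⟨a2, b2⟩ := sqrt2_bounds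
  obtain ⟨a3, b3⟩ := sqrt3_bounds
  obtain ⟨a6, b6⟩ := sqrt6_bounds
  nlinarith

/-- `η₂(15) > 12.026` (desk `12.0269`). -/
theorem eta2_R13_15_gt :
    (12.026 : ℝ) < (1 / 13 : ℝ) * 15 ^ 2 + (-(1 / 100000 : ℝ)) - (2 * Real.sqrt 3 + Real.sqrt 2)
        - (Real.sqrt 6 + 2 * Real.sqrt 3) / 15 - Real.sqrt 3 / 15 ^ 2 := by
  obtain ⟨a2, b2⟩ := sqrt2_bounds
  obtain ⟨a3, b3⟩ := sqrt3_bounds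
  obtain ⟨a6, b6⟩ := sqrt6_bounds
  nlinarith

/-- `η₂(17) > 16.998` (desk `16.9990`). -/
theorem eta2_R13_17_gt :
    (16.998 : ℝ) < (1 / 13 : ℝ) * 17 ^ 2 + (-(1 / 100000 : ℝ)) - (2 * Real.sqrt 3 + Real.sqrt 2)
        - (Real.sqrt 6 + 2 * Real.sqrt 3) / 17 - Real.sqrt 3 / 17 ^ 2 := by
  obtain ⟨a2, b2⟩ := sqrt2_bounds
  obtain ⟨a3, b3⟩ := sqrt3_bounds
  obtain ⟨a6, b6⟩ := sqrt6_bounds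
  nlinarith

/-- **The `H²` tail form at `R = 13`, `ω = −1/100000`, head cut-off `K`, as a number.** For
`U = Torus.abcFlow 1 1 1` on the unit torus and every smooth `w` whose Fourier coefficients vanish
on the cube `|k|_∞ ≤ K`: if `c ≤ η₂(K+1)` then
`(ν/4π²)∫⟪ΔΔw,Δw⟫ − (1/2π)∫⟪(U·∇)w + (w·∇)U, ΔΔw⟫ − ω‖Δw‖₂² ≤ −c‖Δw‖₂²` with `ν = 1/13`,
`ω = −1/100000` (`AbcFlowCubeTailForms.abc_cube_h2_tail_form_le` + the threshold). -/
theorem abc_cube_h2_tail_at_R13 {w : UnitAddTorus (Fin 3) → EuclideanSpace ℝ (Fin 3)} (hw : IsSmooth w)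
    {K : ℕ} (hcube : ∀ k : Fin 3 → ℤ, (∀ i, |k i| ≤ (K : ℤ)) →
      mFourierCoeff (EuclideanSpace.complexify ∘ w) k = 0)
    {c : ℝ} (hc : c ≤ (1 / 13 : ℝ) * ((K : ℝ) + 1) ^ 2 + (-(1 / 100000 : ℝ))
        - (2 * Real.sqrt 3 + Real.sqrt 2) - (Real.sqrt 6 + 2 * Real.sqrt 3) / ((K : ℝ) + 1)
        - Real.sqrt 3 / ((K : ℝ) + 1) ^ 2) :
    (1 / 13 : ℝ) / (4 * Real.pi ^ 2) * (∫ y, ⟪laplacian (laplacian w) y, laplacian w y⟫)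
      - 1 / (2 * Real.pi) * (∫ y, ⟪convect (Torus.abcFlow 1 1 1) w y + convect w (Torus.abcFlow 1 1 1) y,
          laplacian (laplacian w) y⟫)
      - (-(1 / 100000 : ℝ)) * (∫ y, ‖laplacian w y‖ ^ 2)
      ≤ -c * (∫ y, ‖laplacian w y‖ ^ 2) := by
  have h := abc_cube_h2_tail_form_le hw hcube (ν := 1 / 13) (ω := -(1 / 100000 : ℝ)) (by norm_num)
  have hY : 0 ≤ ∫ y, ‖laplacian w y‖ ^ 2 := integral_nonneg fun y => sq_nonneg _
  refine h.trans (mul_le_mul_of_nonneg_right ?_ hY)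
  linarith

/-- Ladder rung `(K, K_h, KTAIL) = (10, 6, 9)`: tail `|k|_∞ ≥ 11`, `η₂ ≥ 3.876`. -/
theorem abc_cube_h2_tail_at_R13_K10 {w : UnitAddTorus (Fin 3) → EuclideanSpace ℝ (Fin 3)} (hw : IsSmooth w)
    (hcube : ∀ k : Fin 3 → ℤ, (∀ i, |k i| ≤ ((10 : ℕ) : ℤ)) →
      mFourierCoeff (EuclideanSpace.complexify ∘ w) k = 0) :
    (1 / 13 : ℝ) / (4 * Real.pi ^ 2) * (∫ y, ⟪laplacian (laplacian w) y, laplacian w y⟫)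
      - 1 / (2 * Real.pi) * (∫ y, ⟪convect (Torus.abcFlow 1 1 1) w y + convect w (Torus.abcFlow 1 1 1) y,
          laplacian (laplacian w) y⟫)
      - (-(1 / 100000 : ℝ)) * (∫ y, ‖laplacian w y‖ ^ 2)
      ≤ -(3.876 : ℝ) * (∫ y, ‖laplacian w y‖ ^ 2) :=
  abc_cube_h2_tail_at_R13 hw hcube (by
    have h := eta2_R13_11_gt
    norm_num at h ⊢
    linarith)

/-- Ladder rung `(12, 8, 11)`: tail `|k|_∞ ≥ 13`, `η₂ ≥ 7.655`. -/
theorem abc_cube_h2_tail_at_R13_K12 {w : UnitAddTorus (Fin 3) → EuclideanSpace ℝ (Fin 3)} (hw : IsSmooth w)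
    (hcube : ∀ k : Fin 3 → ℤ, (∀ i, |k i| ≤ ((12 : ℕ) : ℤ)) →
      mFourierCoeff (EuclideanSpace.complexify ∘ w) k = 0) :
    (1 / 13 : ℝ) / (4 * Real.pi ^ 2) * (∫ y, ⟪laplacian (laplacian w) y, laplacian w y⟫)
      - 1 / (2 * Real.pi) * (∫ y, ⟪convect (Torus.abcFlow 1 1 1) w y + convect w (Torus.abcFlow 1 1 1) y,
          laplacian (laplacian w) y⟫)
      - (-(1 / 100000 : ℝ)) * (∫ y, ‖laplacian w y‖ ^ 2)
      ≤ -(7.655 : ℝ) * (∫ y, ‖laplacian w y‖ ^ 2) :=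
  abc_cube_h2_tail_at_R13 hw hcube (by
    have h := eta2_R13_13_gt
    norm_num at h ⊢
    linarith)

/-- Ladder rung `(13, 9, 12)`: tail `|k|_∞ ≥ 14`, `η₂ ≥ 9.766`. -/
theorem abc_cube_h2_tail_at_R13_K13 {w : UnitAddTorus (Fin 3) → EuclideanSpace ℝ (Fin 3)} (hw : IsSmooth w)
    (hcube : ∀ k : Fin 3 → ℤ, (∀ i, |k i| ≤ ((13 : ℕ) : ℤ)) →
      mFourierCoeff (EuclideanSpace.complexify ∘ w) k = 0) :
    (1 / 13 : ℝ) / (4 * Real.pi ^ 2) * (∫ y, ⟪laplacian (laplacian w) y, laplacian w y⟫)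
      - 1 / (2 * Real.pi) * (∫ y, ⟪convect (Torus.abcFlow 1 1 1) w y + convect w (Torus.abcFlow 1 1 1) y,
          laplacian (laplacian w) y⟫)
      - (-(1 / 100000 : ℝ)) * (∫ y, ‖laplacian w y‖ ^ 2)
      ≤ -(9.766 : ℝ) * (∫ y, ‖laplacian w y‖ ^ 2) :=
  abc_cube_h2_tail_at_R13 hw hcube (by
    have h := eta2_R13_14_gt
    norm_num at h ⊢
    linarith)

/-- Ladder rung `(14, 10, 13)`: tail `|k|_∞ ≥ 15`, `η₂ ≥ 12.026`. -/
theorem abc_cube_h2_tail_at_R13_K14 {w : UnitAddTorus (Fin 3) → EuclideanSpace ℝ (Fin 3)} (hw : IsSmooth w)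
    (hcube : ∀ k : Fin 3 → ℤ, (∀ i, |k i| ≤ ((14 : ℕ) : ℤ)) →
      mFourierCoeff (EuclideanSpace.complexify ∘ w) k = 0) :
    (1 / 13 : ℝ) / (4 * Real.pi ^ 2) * (∫ y, ⟪laplacian (laplacian w) y, laplacian w y⟫)
      - 1 / (2 * Real.pi) * (∫ y, ⟪convect (Torus.abcFlow 1 1 1) w y + convect w (Torus.abcFlow 1 1 1) y,
          laplacian (laplacian w) y⟫)
      - (-(1 / 100000 : ℝ)) * (∫ y, ‖laplacian w y‖ ^ 2)
      ≤ -(12.026 : ℝ) * (∫ y, ‖laplacian w y‖ ^ 2) :=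
  abc_cube_h2_tail_at_R13 hw hcube (by
    have h := eta2_R13_15_gt
    norm_num at h ⊢
    linarith)

/-- Ladder rung `(16, 12, 15)`: tail `|k|_∞ ≥ 17`, `η₂ ≥ 16.998`. -/
theorem abc_cube_h2_tail_at_R13_K16 {w : UnitAddTorus (Fin 3) → EuclideanSpace ℝ (Fin 3)} (hw : IsSmooth w)
    (hcube : ∀ k : Fin 3 → ℤ, (∀ i, |k i| ≤ ((16 : ℕ) : ℤ)) →
      mFourierCoeff (EuclideanSpace.complexify ∘ w) k = 0) :
    (1 / 13 : ℝ) / (4 * Real.pi ^ 2) * (∫ y, ⟪laplacian (laplacian w) y, laplacian w y⟫)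
      - 1 / (2 * Real.pi) * (∫ y, ⟪convect (Torus.abcFlow 1 1 1) w y + convect w (Torus.abcFlow 1 1 1) y,
          laplacian (laplacian w) y⟫)
      - (-(1 / 100000 : ℝ)) * (∫ y, ‖laplacian w y‖ ^ 2)
      ≤ -(16.998 : ℝ) * (∫ y, ‖laplacian w y‖ ^ 2) :=
  abc_cube_h2_tail_at_R13 hw hcube (by
    have h := eta2_R13_17_gt
    norm_num at h ⊢
    linarith)

end Summit.NavierStokesRegularity.FluidComputer.AbcFlowCubeTailAtR13
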